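import Summits.QuantumFields.BalabanUV.T4Continuum.Spine.NE9.DirectPairingPropagation
import Summits.QuantumFields.BalabanUV.T4Continuum.Spine.NE9.TowerCarriersKing

/-!
# T⁴ programme, spine estimate NE9 — THE PROPAGATED KING-CURRENCY INPUT ON THE TOWER OF CARRIERS: one Markov recursion PER RUN,
# [UC-LAST] + [UC-OLD] uniform over the runs ⇒ `TowerCarriersKing`'s carriers-level hypothesis BY NAME ⇒ node U6 in King's currency;
# the uniformity of [UC-LAST] over the old data is FREE on a totally bounded class given [UC-OLD]; the g → t currency transfer of
# uniform continuity — census item C33 (carriers junction and riders) of cell `pub-balaban-gaps`, seat ne9 (gen 7)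

Cell `pub-balaban-gaps` (YM blitz G2, seat ne9, unit `pub-balaban-gaps-ne9-g7`; record `run/shared/lean/pub/pub-balaban-gaps/ne/NE9.md` §5 row
C33).  Summits-side bookkeeping; real analysis on hypothesis SHAPES; no definition; nothing of Bałaban's asserted.

WHY (modelling remark, honest).  `DirectPairingPropagation` §3 states its ENDs for a family of Markov recursions each of which carries
its OWN tower rate between consecutive levels — the situation of the cell's toy towers (one recursion read in every run).  On the tower of
carriers (`TowerCarriers.TowerData`) the recursion runs WITHIN a run (`k` fixed, levels `j = 0, 1, …`: [Balaban1987RG1] p. 256), whereas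
the tower rate (`TowerCarriersBox.TowerNE5On`) and King's sections (`TowerCarriersKing.kingSection`) compare DIFFERENT runs at one physical
domain.  The right junction is therefore: propagate PER RUN (family index = the run `k`, §2 of `DirectPairingPropagation` with `σ = ℕ`),
read the scale-`m` term of run `k` at domain `X` (`r X + m = k`) from the level-`m` state by a read-out uniformly continuous on the class
uniformly over the runs ∕ backgrounds ∕ domains of that scale — this gives EXACTLY the carriers-level separate-uniform-continuity hypothesis
`hUC` of `TowerCarriersKing.directBracket_eventually_le_carriers` ∕ `king_U6_of_carriers` (§1), and those theorems do the rest BY NAME.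

WHAT IS PROVED.
* §1 `prefix_carriers_of_markov` (prefix dependence of the terms from the per-run Markov recursions), **`sepUC_carriers_of_propagation`**
  (per-run [UC-LAST] + [UC-OLD], moduli uniform over the runs, + read-outs ⇒ `TowerCarriersKing`'s `hUC` VERBATIM),
  **`directBracket_eventually_le_carriers_of_propagation`** and **`king_U6_of_propagation`** (the King-currency ENDs on the carriers BY NAME:
  `TowerNE5On` + per-run recursions + [UC-LAST] + [UC-OLD] + read-outs (+ the (1.18)-type bound, node U2's summable consecutive profile) ⇒
  a scale profile `b_j → 0` dominating every direct bracket and `T4CauchySum.delta → 0`).  NO hypothesis names a coupling other than the last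
  one of each step; NO constant of the step.
* §2 `uniformLast_of_net` — the UNIFORMITY of [UC-LAST] over the old data is FREE on a TOTALLY BOUNDED class: pointwise-in-the-old-datum
  uniform continuity in the last coupling (print's clause read per fixed old action, [I] p. 263) + [UC-OLD] + finite `δ`-nets inside the class
  ⇒ [UC-LAST] with one `δ` for the whole class (ε∕3).  At a FIXED lattice an (1.18)-bounded class of local terms is a bounded subset of a
  finite-dimensional space — totally bounded (READING; not typed for Bałaban's objects); across the runs it is the uniformity over `k` that
  remains the hypothesis (printed KIND, [I] Thm 1 p. 259).
* §3 `sepUC_tCoord_of_gCoord` — CURRENCY: separate uniform continuity in the g-window `]0, γ]` implies it in node U2's t-box `[γ⁻², ∞[` for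
  the re-parametrised tower `t ↦ F m (1∕√t)` (`T4CouplingAnalyticity.ofT`, `abs_sub_le_of_window`: `|g − g'| ≤ (γ³∕2)|g⁻² − g'⁻²|`), with
  `δ_t = (2∕γ³)·δ_g`; print's clause lives on the CLOSED g-interval (continuity there ⇒ uniform continuity on `]0, γ]` ⇒ the t-form), the
  converse transfer fails (`t = g⁻²` is not uniformly continuous at `g → 0`) and is not needed.

HONEST FRAMING: bookkeeping for rung (B)+1 on ONE FIXED finite four-torus; tower-NE5 is the cell's estimate NE5 (NOT PRINTED, NOT PROVED);
[UC-LAST]∕[UC-OLD] for Bałaban's step NOT PRINTED as theorems ∕ NOT PROVED; NE9 NOT PRINTED ∕ NOT PROVED; spine PROVED 0∕9 unchanged;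
instance 0∕1; NOT UV stability, NOT the continuum limit, NOT infinite volume, NOT a mass gap, NOT Clay.  Classification of NE9 UNCHANGED
(WORK-bound on W1).

References (TYPES only): [Balaban1987RG1] = T. Bałaban, Commun. Math. Phys. **109** (1987) 249–301, p. 256, Thm 1 p. 259, (1.18) p. 263;
[King1986] = C. King, Commun. Math. Phys. **102** (1986) 649–677, §3.2 pp. 656–657.
-/

namespace Summit.QuantumFields.BalabanUV.T4Continuum.NE9.DirectPairingPropagationCarriers

open scoped BigOperators
open Finset Filter Topology Metric Set
open Literature.MathematicalPhysics.QuantumFieldTheory.Balaban1983to89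
open Literature.MathematicalPhysics.QuantumFieldTheory.Balaban1983to89.T4OutputRate (Window)
open Literature.MathematicalPhysics.QuantumFieldTheory.Balaban1983to89.T4CouplingAnalyticity
  (BoxWindow ofT ofT_mem_window ofT_sq_inv abs_sub_le_of_window)
open T4CauchySum (delta)
open Summit.QuantumFields.BalabanUV.T4Continuum.NE9.TowerCarriers
open Summit.QuantumFields.BalabanUV.T4Continuum.NE9.TowerCarriersBox (TowerNE5On)
open Summit.QuantumFields.BalabanUV.T4Continuum.NE9.TowerCarriersKing
  (directBracket_eventually_le_carriers king_U6_of_carriers)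
open Summit.QuantumFields.BalabanUV.T4Continuum.NE9.DirectPairingPropagation (prefix_of_markov sepUC_of_propagation)

/-! ## §1 One Markov recursion per run ⇒ the carriers-level hypothesis of `TowerCarriersKing` BY NAME ⇒ node U6 -/

section Carriers

variable (T : TowerData) {E : ℕ → (ℕ → ℝ) → T.B → T.Dom → ℝ} {I : Set ℝ} {κ : ℝ}
variable {S : Type*} [PseudoMetricSpace S] {V : ℕ → ℕ → (ℕ → ℝ) → S} {Φ : ℕ → ℕ → ℝ → S → S} {A : ℕ → Set S}
  {ev : ℕ → T.B → T.Dom → S → ℝ}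

omit [PseudoMetricSpace S] in
/-- **PREFIX DEPENDENCE OF THE TERMS** from the per-run Markov recursions: run `k`'s scale-`(k − r X)` term at `X`, read from the
level-`(k − r X)` state (`hE`; for a domain not yet born in run `k` the truncated difference reads the coupling-free level `0`), depends on the
couplings below its scale only — the `hP` hypothesis of `TowerCarriersKing`. [folklore] -/
theorem prefix_carriers_of_markov
    (h0 : ∀ k, ∀ g ∈ BoxWindow I, ∀ g' ∈ BoxWindow I, V k 0 g = V k 0 g')
    (hrec : ∀ k j, ∀ g ∈ BoxWindow I, V k (j + 1) g = Φ k j (g j) (V k j g))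
    (hE : ∀ (k : ℕ) (U : T.B) (X : T.Dom), ∀ g ∈ BoxWindow I, E k g U X = ev k U X (V k (k - T.r X) g)) :
    ∀ (k : ℕ) (U : T.B) (X : T.Dom), ∀ g ∈ BoxWindow I, ∀ g' ∈ BoxWindow I,
      (∀ i, i < k - T.r X → g i = g' i) → E k g U X = E k g' U X := by
  intro k U X g hg g' hg' hagree
  rw [hE k U X g hg, hE k U X g' hg', prefix_of_markov h0 hrec k (k - T.r X) g hg g' hg' hagree]

/-- **THE CARRIERS-LEVEL INPUT FROM THE STEP CLAUSES.**  One Markov recursion per run `k` (states `V k j g`, coupling-free start, classes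
`A j`), [UC-OLD] and [UC-LAST] per level with moduli uniform over the runs, and read-outs `ev k U X` of the scale-`m` term (`r X + m = k`)
from the level-`m` state that are uniformly continuous on `A m` uniformly over the runs ∕ backgrounds ∕ domains of scale `m`, in the
normalisation `e^{κd(X)}·|·|` ⇒ the separate-uniform-continuity hypothesis `hUC` of `TowerCarriersKing.directBracket_eventually_le_carriers`
VERBATIM.  The propagation is `DirectPairingPropagation.sepUC_of_propagation` with family index = the run. [folklore] -/
theorem sepUC_carriers_of_propagation
    (h0 : ∀ k, ∀ g ∈ BoxWindow I, ∀ g' ∈ BoxWindow I, V k 0 g = V k 0 g')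
    (hrec : ∀ k j, ∀ g ∈ BoxWindow I, V k (j + 1) g = Φ k j (g j) (V k j g))
    (hmem : ∀ k m, ∀ g ∈ BoxWindow I, V k m g ∈ A m)
    (hold : ∀ j, ∀ ε : ℝ, 0 < ε → ∃ δ : ℝ, 0 < δ ∧ ∀ k, ∀ c ∈ I, ∀ w ∈ A j, ∀ w' ∈ A j,
      dist w w' ≤ δ → dist (Φ k j c w) (Φ k j c w') ≤ ε)
    (hlast : ∀ j, ∀ ε : ℝ, 0 < ε → ∃ δ : ℝ, 0 < δ ∧ ∀ k, ∀ w ∈ A j, ∀ c ∈ I, ∀ c' ∈ I,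
      |c - c'| ≤ δ → dist (Φ k j c w) (Φ k j c' w) ≤ ε)
    (hev : ∀ m, ∀ ε : ℝ, 0 < ε → ∃ δ : ℝ, 0 < δ ∧ ∀ (k : ℕ) (U : T.B) (X : T.Dom), T.r X + m = k →
      ∀ w ∈ A m, ∀ w' ∈ A m, dist w w' ≤ δ → Real.exp (κ * T.d X) * |ev k U X w - ev k U X w'| ≤ ε)
    (hE : ∀ (k : ℕ) (U : T.B) (X : T.Dom), ∀ g ∈ BoxWindow I, E k g U X = ev k U X (V k (k - T.r X) g)) :
    ∀ m i : ℕ, i < m → ∀ ε : ℝ, 0 < ε → ∃ δ : ℝ, 0 < δ ∧ ∀ (k : ℕ) (U : T.B) (X : T.Dom), T.r X + m = k →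
      ∀ g ∈ BoxWindow I, ∀ g' ∈ BoxWindow I, (∀ j, j ≠ i → g j = g' j) → |g i - g' i| ≤ δ →
        Real.exp (κ * T.d X) * |E k g U X - E k g' U X| ≤ ε := by
  intro m i hi ε hε
  obtain ⟨δ₁, hδ₁, hR⟩ := hev m ε hε
  obtain ⟨δ, hδ, hS⟩ := sepUC_of_propagation (σ := ℕ) (V := V) (Φ := Φ) (A := A) h0 hrec hmem hold hlast m i hi δ₁ hδ₁
  refine ⟨δ, hδ, fun k U X hk g hg g' hg' hagree hdiff => ?_⟩
  have hkm : k - T.r X = m := by omega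
  rw [hE k U X g hg, hE k U X g' hg', hkm]
  exact hR k U X hk _ (hmem k m g hg) _ (hmem k m g' hg') (hS k g hg g' hg' hagree hdiff)

/-- **KING'S CURRENCY ON THE CARRIERS FROM THE STEP CLAUSES** (`TowerCarriersKing.directBracket_eventually_le_carriers` BY NAME):
`TowerNE5On T E I κ θ C₅` + one Markov recursion per run with [UC-LAST] + [UC-OLD] uniform over the runs + uniformly continuous read-outs + a
coordinatewise profile `P_i → 0` ⇒ ONE scale threshold beyond which every direct bracket of runs `k`, `k + n` at every background and
domain is `≤ η·e^{−κd(X)}`, uniformly in `n`.  NO statement about an older coupling, NO constant of the step. [folklore] -/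
theorem directBracket_eventually_le_carriers_of_propagation {θ C₅ : ℝ} {P : ℕ → ℝ}
    (hC : 0 ≤ C₅) (hθ0 : 0 ≤ θ) (hθ1 : θ < 1) (h5 : TowerNE5On T E I κ θ C₅)
    (h0 : ∀ k, ∀ g ∈ BoxWindow I, ∀ g' ∈ BoxWindow I, V k 0 g = V k 0 g')
    (hrec : ∀ k j, ∀ g ∈ BoxWindow I, V k (j + 1) g = Φ k j (g j) (V k j g))
    (hmem : ∀ k m, ∀ g ∈ BoxWindow I, V k m g ∈ A m)
    (hold : ∀ j, ∀ ε : ℝ, 0 < ε → ∃ δ : ℝ, 0 < δ ∧ ∀ k, ∀ c ∈ I, ∀ w ∈ A j, ∀ w' ∈ A j,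
      dist w w' ≤ δ → dist (Φ k j c w) (Φ k j c w') ≤ ε)
    (hlast : ∀ j, ∀ ε : ℝ, 0 < ε → ∃ δ : ℝ, 0 < δ ∧ ∀ k, ∀ w ∈ A j, ∀ c ∈ I, ∀ c' ∈ I,
      |c - c'| ≤ δ → dist (Φ k j c w) (Φ k j c' w) ≤ ε)
    (hev : ∀ m, ∀ ε : ℝ, 0 < ε → ∃ δ : ℝ, 0 < δ ∧ ∀ (k : ℕ) (U : T.B) (X : T.Dom), T.r X + m = k →
      ∀ w ∈ A m, ∀ w' ∈ A m, dist w w' ≤ δ → Real.exp (κ * T.d X) * |ev k U X w - ev k U X w'| ≤ ε)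
    (hE : ∀ (k : ℕ) (U : T.B) (X : T.Dom), ∀ g ∈ BoxWindow I, E k g U X = ev k U X (V k (k - T.r X) g))
    (hd : Tendsto P atTop (𝓝 0)) {η : ℝ} (hη : 0 < η) :
    ∃ M₀ : ℕ, ∀ (k n : ℕ) (U : T.B) (X : T.Dom), T.r X + M₀ ≤ k →
      ∀ g ∈ BoxWindow I, ∀ g' ∈ BoxWindow I, (∀ i, i < k - T.r X → |g (i + n) - g' i| ≤ P i) →
        |E (k + n) g U X - E k g' (T.descend (k + n) U k) X| ≤ η * Real.exp (-(κ * T.d X)) :=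
  directBracket_eventually_le_carriers T hC hθ0 hθ1 h5 (prefix_carriers_of_markov T h0 hrec hE)
    (sepUC_carriers_of_propagation T h0 hrec hmem hold hlast hev hE) hd hη

/-- **NODE U6 IN KING'S CURRENCY FROM THE STEP CLAUSES** (`TowerCarriersKing.king_U6_of_carriers` BY NAME): add the (1.18)-type bound
`e^{κd(X)}·|E k g U X| ≤ B` and node U2's nonnegative summable K-uniform CONSECUTIVE matching profile along the run histories `t K` ⇒ a scale
profile `b_j → 0` dominating the direct bracket of the runs `K`, `K + n` at every background and domain, and `T4CauchySum.delta E₀ ρ inj K → 0`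
for every injection under it.  E-side inputs: tower-NE5, [UC-LAST], [UC-OLD], read-outs — NOTHING about the coupling history. [folklore] -/
theorem king_U6_of_propagation {θ C₅ B : ℝ} {p : ℕ → ℝ} {t : ℕ → ℕ → ℝ}
    (hC : 0 ≤ C₅) (hθ0 : 0 ≤ θ) (hθ1 : θ < 1) (h5 : TowerNE5On T E I κ θ C₅)
    (h0 : ∀ k, ∀ g ∈ BoxWindow I, ∀ g' ∈ BoxWindow I, V k 0 g = V k 0 g')
    (hrec : ∀ k j, ∀ g ∈ BoxWindow I, V k (j + 1) g = Φ k j (g j) (V k j g))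
    (hmem : ∀ k m, ∀ g ∈ BoxWindow I, V k m g ∈ A m)
    (hold : ∀ j, ∀ ε : ℝ, 0 < ε → ∃ δ : ℝ, 0 < δ ∧ ∀ k, ∀ c ∈ I, ∀ w ∈ A j, ∀ w' ∈ A j,
      dist w w' ≤ δ → dist (Φ k j c w) (Φ k j c w') ≤ ε)
    (hlast : ∀ j, ∀ ε : ℝ, 0 < ε → ∃ δ : ℝ, 0 < δ ∧ ∀ k, ∀ w ∈ A j, ∀ c ∈ I, ∀ c' ∈ I,
      |c - c'| ≤ δ → dist (Φ k j c w) (Φ k j c' w) ≤ ε)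
    (hev : ∀ m, ∀ ε : ℝ, 0 < ε → ∃ δ : ℝ, 0 < δ ∧ ∀ (k : ℕ) (U : T.B) (X : T.Dom), T.r X + m = k →
      ∀ w ∈ A m, ∀ w' ∈ A m, dist w w' ≤ δ → Real.exp (κ * T.d X) * |ev k U X w - ev k U X w'| ≤ ε)
    (hE : ∀ (k : ℕ) (U : T.B) (X : T.Dom), ∀ g ∈ BoxWindow I, E k g U X = ev k U X (V k (k - T.r X) g))
    (hB0 : 0 ≤ B) (hB : ∀ (k : ℕ) (U : T.B) (X : T.Dom), ∀ g ∈ BoxWindow I, Real.exp (κ * T.d X) * |E k g U X| ≤ B)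
    (ht : ∀ K, t K ∈ BoxWindow I) (hp : ∀ K i, |t (K + 1) (i + 1) - t K i| ≤ p i) (hp0 : ∀ i, 0 ≤ p i) (hps : Summable p) :
    ∃ b : ℕ → ℝ, (∀ j, 0 ≤ b j) ∧ Tendsto b atTop (𝓝 0) ∧
      (∀ (K n : ℕ) (U : T.B) (X : T.Dom), T.r X ≤ K →
        |E (K + n) (t (K + n)) U X - E K (t K) (T.descend (K + n) U K) X| ≤ b (K - T.r X) * Real.exp (-(κ * T.d X))) ∧
      ∀ (E₀ ρ : ℝ) (inj : ℕ → ℕ → ℝ), 0 ≤ E₀ → 0 ≤ ρ → ρ < 1 →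
        (∀ K j : ℕ, j ≤ K → 0 ≤ inj K j ∧ inj K j ≤ b j) → Tendsto (delta E₀ ρ inj) atTop (𝓝 0) :=
  king_U6_of_carriers T hC hθ0 hθ1 h5 (prefix_carriers_of_markov T h0 hrec hE)
    (sepUC_carriers_of_propagation T h0 hrec hmem hold hlast hev hE) hB0 hB ht hp hp0 hps

end Carriers

/-! ## §2 On a totally bounded class the uniformity of [UC-LAST] over the old data is free, given [UC-OLD] -/

section Net

variable {S : Type*} [PseudoMetricSpace S] {I : Set ℝ}

/-- Finite families of positive thresholds have a common one (for properties monotone in the threshold). [folklore] -/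
theorem exists_common_delta {ι : Type*} (t : Finset ι) (P : ι → ℝ → Prop)
    (hmono : ∀ i δ δ', δ' ≤ δ → P i δ → P i δ') (h : ∀ i ∈ t, ∃ δ : ℝ, 0 < δ ∧ P i δ) :
    ∃ δ : ℝ, 0 < δ ∧ ∀ i ∈ t, P i δ := by
  classical
  induction t using Finset.induction_on with
  | empty => exact ⟨1, one_pos, by simp⟩
  | insert a s ha ih =>
    obtain ⟨δ₁, hδ₁, h₁⟩ := h a (Finset.mem_insert_self a s)
    obtain ⟨δ₂, hδ₂, h₂⟩ := ih fun i hi => h i (Finset.mem_insert_of_mem hi)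
    refine ⟨min δ₁ δ₂, lt_min hδ₁ hδ₂, fun i hi => ?_⟩
    rcases Finset.mem_insert.mp hi with rfl | hi
    · exact hmono _ _ _ (min_le_left _ _) h₁
    · exact hmono _ _ _ (min_le_right _ _) (h₂ i hi)

/-- **[UC-LAST]'s UNIFORMITY OVER THE OLD DATA IS FREE ON A TOTALLY BOUNDED CLASS.**  If the class `K` has a finite `δ`-net inside itself
for every `δ > 0` (`hnet`; total boundedness), the step is uniformly continuous in the last coupling for EACH FIXED old datum of the class
(`hpt` — print's clause read per fixed old action, [Balaban1987RG1] p. 263), and [UC-OLD] holds uniformly in the last coupling (`hold`), then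
the step is uniformly continuous in the last coupling UNIFORMLY over the class (ε∕3 through the net).  What remains a genuine hypothesis
is the uniformity over an infinite family of runs. [folklore] -/
theorem uniformLast_of_net {Φ₁ : ℝ → S → S} {K : Set S}
    (hnet : ∀ δ : ℝ, 0 < δ → ∃ t : Finset S, (∀ y ∈ t, y ∈ K) ∧ ∀ w ∈ K, ∃ y ∈ t, dist w y ≤ δ)
    (hpt : ∀ w ∈ K, ∀ ε : ℝ, 0 < ε → ∃ δ : ℝ, 0 < δ ∧ ∀ c ∈ I, ∀ c' ∈ I, |c - c'| ≤ δ → dist (Φ₁ c w) (Φ₁ c' w) ≤ ε)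
    (hold : ∀ ε : ℝ, 0 < ε → ∃ δ : ℝ, 0 < δ ∧ ∀ c ∈ I, ∀ w ∈ K, ∀ w' ∈ K, dist w w' ≤ δ → dist (Φ₁ c w) (Φ₁ c w') ≤ ε)
    {ε : ℝ} (hε : 0 < ε) :
    ∃ δ : ℝ, 0 < δ ∧ ∀ w ∈ K, ∀ c ∈ I, ∀ c' ∈ I, |c - c'| ≤ δ → dist (Φ₁ c w) (Φ₁ c' w) ≤ ε := by
  obtain ⟨δ₁, hδ₁, hO⟩ := hold (ε / 3) (by positivity)
  obtain ⟨t, htK, ht⟩ := hnet δ₁ hδ₁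
  obtain ⟨δ, hδ, hP⟩ := exists_common_delta t
    (fun y δ => ∀ c ∈ I, ∀ c' ∈ I, |c - c'| ≤ δ → dist (Φ₁ c y) (Φ₁ c' y) ≤ ε / 3)
    (fun y δ δ' hle h c hc c' hc' hcc' => h c hc c' hc' (hcc'.trans hle))
    (fun y hy => hpt y (htK y hy) (ε / 3) (by positivity))
  refine ⟨δ, hδ, fun w hw c hc c' hc' hcc' => ?_⟩
  obtain ⟨y, hy, hwy⟩ := ht w hw
  have hyK : y ∈ K := htK y hy
  have h1 : dist (Φ₁ c w) (Φ₁ c y) ≤ ε / 3 := hO c hc w hw y hyK hwy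
  have h2 : dist (Φ₁ c y) (Φ₁ c' y) ≤ ε / 3 := hP y hy c hc c' hc' hcc'
  have h3 : dist (Φ₁ c' y) (Φ₁ c' w) ≤ ε / 3 := by
    rw [dist_comm]; exact hO c' hc' w hw y hyK hwy
  calc dist (Φ₁ c w) (Φ₁ c' w) ≤ dist (Φ₁ c w) (Φ₁ c y) + dist (Φ₁ c y) (Φ₁ c' y) + dist (Φ₁ c' y) (Φ₁ c' w) :=
        dist_triangle4 _ _ _ _
    _ ≤ ε := by linarith

/-- Mathlib's `TotallyBounded K` supplies the nets of `uniformLast_of_net` (net points inside `K`: `totallyBounded_iff_subset`). [folklore] -/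
theorem net_of_totallyBounded {K : Set S} (hK : TotallyBounded K) {δ : ℝ} (hδ : 0 < δ) :
    ∃ t : Finset S, (∀ y ∈ t, y ∈ K) ∧ ∀ w ∈ K, ∃ y ∈ t, dist w y ≤ δ := by
  obtain ⟨t, htK, htfin, hcov⟩ := totallyBounded_iff_subset.1 hK _ (Metric.dist_mem_uniformity hδ)
  refine ⟨htfin.toFinset, fun y hy => htK (htfin.mem_toFinset.1 hy), fun w hw => ?_⟩
  obtain ⟨y, hy, hwy⟩ := Set.mem_iUnion₂.1 (hcov hw)
  exact ⟨y, htfin.mem_toFinset.2 hy, le_of_lt hwy⟩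

end Net

/-! ## §3 Currency: separate uniform continuity in the g-window gives it in node U2's t-box -/

/-- **g → t TRANSFER OF SEPARATE UNIFORM CONTINUITY.**  If a tower on the g-window `Window γ` (`γ > 0`) is separately uniformly continuous in
coordinate `i` at level `m` (modulus `δ` at tolerance `ε`), then the re-parametrised tower `t ↦ F m (ofT t)` (`g_i = 1∕√t_i`) on the t-box
`BoxWindow [γ⁻², ∞[` is so with modulus `(2∕γ³)·δ` — `abs_sub_le_of_window`: `|g − g'| ≤ (γ³∕2)·|g⁻² − g'⁻²|`.  Print's clause lives on the
CLOSED g-interval; the converse transfer (t → g) fails near `g = 0` and is not needed. [folklore] -/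
theorem sepUC_tCoord_of_gCoord {F : ℕ → (ℕ → ℝ) → ℝ} {γ : ℝ} (hγ : 0 < γ) {m i : ℕ} {ε δ : ℝ} (hδ : 0 < δ)
    (h : ∀ g ∈ Window γ, ∀ g' ∈ Window γ, (∀ k, k ≠ i → g k = g' k) → |g i - g' i| ≤ δ → |F m g - F m g'| ≤ ε) :
    ∃ δ' : ℝ, 0 < δ' ∧ ∀ t ∈ BoxWindow (Ici (γ ^ 2)⁻¹), ∀ t' ∈ BoxWindow (Ici (γ ^ 2)⁻¹),
      (∀ k, k ≠ i → t k = t' k) → |t i - t' i| ≤ δ' → |F m (ofT t) - F m (ofT t')| ≤ ε := by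
  refine ⟨2 / γ ^ 3 * δ, by positivity, fun t ht t' ht' hagree hdiff => ?_⟩
  have hg := ofT_mem_window hγ ht
  have hg' := ofT_mem_window hγ ht'
  refine h (ofT t) hg (ofT t') hg' (fun k hk => by simp only [ofT, hagree k hk]) ?_
  have hti : 0 ≤ t i := le_trans (by positivity) (ht i)
  have ht'i : 0 ≤ t' i := le_trans (by positivity) (ht' i)
  have hd := abs_sub_le_of_window (hg i).1 (hg i).2 (hg' i).1 (hg' i).2
  rw [ofT_sq_inv hti, ofT_sq_inv ht'i] at hd
  have hγ3 : 0 < γ ^ 3 := by positivity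
  calc |ofT t i - ofT t' i| ≤ γ ^ 3 / 2 * |t i - t' i| := hd
    _ ≤ γ ^ 3 / 2 * (2 / γ ^ 3 * δ) := mul_le_mul_of_nonneg_left hdiff (by positivity)
    _ = δ := by field_simp

end Summit.QuantumFields.BalabanUV.T4Continuum.NE9.DirectPairingPropagationCarriers
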